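import Mathlib
import Literature.NumberTheory.Transcendental.KZSemiCanonicalReductionProofs
import Literature.NumberTheory.Transcendental.KZSemialgebraicComplex

/-!
# Crux `TypeOneIdentities` (stmt-KontsevichZagierPeriods-11368), line `birth`, stub X `stub_discRepExists`

Bookkeeping stub of the registered skeleton `Lines/birth.lean` of the crux
`ComplexOrientations.TypeOneIdentities`: for real algebraic `β` the open disc `{v | v 0 ^ 2 + v 1 ^ 2 < β}`
is `ℚ`-semialgebraic (strict sub-level set of a `ℚ`-semialgebraic function with the algebraic constant `β`)
and bounded, so it carries the integrand-`1` representation (`KZ.exists_oneRep`). Folklore; no definitions.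
-/

noncomputable section

open MeasureTheory Set MvPolynomial
open Literature.ModelTheory.ExponentialFields Literature.NumberTheory.Transcendental

namespace Summit.KontsevichZagierPeriods.ComplexOrientations.TypeOneIdentities

/-- **The open disc of algebraic squared radius is `ℚ`-semialgebraic**: `{v | v 0 ² + v 1 ² < β}` is
the set where the `ℚ`-semialgebraic function `v ↦ v 0 ² + v 1 ²` is below the algebraic constant `β`
(`IsSemialgebraicFunOn.isSemialgebraic_sep_neg` on the difference). [folklore] -/
theorem isSemialgebraic_openDisc {β : ℝ} (hβ : IsAlgebraic ℚ β) :
    IsSemialgebraic ℚ {v : Fin 2 → ℝ | v 0 ^ 2 + v 1 ^ 2 < β} := by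
  have hu : IsSemialgebraicFunOn ℚ (univ : Set (Fin 2 → ℝ)) (fun v => v 0 ^ 2 + v 1 ^ 2) :=
    (isSemialgebraicFunOn_aeval isSemialgebraic_univ (X 0 ^ 2 + X 1 ^ 2)).congr fun v _ => by simp
  have hv : IsSemialgebraicFunOn ℚ (univ : Set (Fin 2 → ℝ)) (fun _ => β) :=
    isSemialgebraicFunOn_const_of_isAlgebraic isSemialgebraic_univ hβ
  have h := (IsSemialgebraicFunOn.sub_holds hu hv).isSemialgebraic_sep_neg
  convert h using 1
  ext v
  simp [sub_neg]

/-- **The open disc has finite area**: it lies in the sup-norm ball of radius `|β| + 1`. [folklore] -/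
theorem volume_openDisc_ne_top (β : ℝ) :
    volume {v : Fin 2 → ℝ | v 0 ^ 2 + v 1 ^ 2 < β} ≠ ⊤ := by
  refine (Bornology.IsBounded.measure_lt_top (μ := volume) ?_).ne
  refine (Metric.isBounded_closedBall (x := (0 : Fin 2 → ℝ)) (r := |β| + 1)).subset ?_
  intro v hv
  have hv' : v 0 ^ 2 + v 1 ^ 2 < β := hv
  rw [mem_closedBall_zero_iff, pi_norm_le_iff_of_nonneg (by positivity)]
  intro i
  rw [Real.norm_eq_abs]
  have hβ : β ≤ |β| := le_abs_self β
  have hi : v i ^ 2 < (|β| + 1) ^ 2 := by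
    have hvi : v i ^ 2 ≤ v 0 ^ 2 + v 1 ^ 2 := by
      fin_cases i
      · simpa using sq_nonneg (v 1)
      · simpa using sq_nonneg (v 0)
    nlinarith [abs_nonneg β]
  exact (abs_lt_of_sq_lt_sq hi (by positivity)).le

/-- **Stub X — `discRepExists` (bookkeeping).** For real algebraic `β` the open disc `{x² + y² < β}`
carries an integrand-`1` representation (`KZ.exists_oneRep` on a `ℚ`-semialgebraic set of finite
volume). [folklore] -/
theorem stub_discRepExists :
    ∀ β : ℝ, IsAlgebraic ℚ β → ∃ e : Literature.NumberTheory.Transcendental.KZ.IntegralRep 2, e.domain = {v : Fin 2 → ℝ | v 0 ^ 2 + v 1 ^ 2 < β} ∧ ∀ v ∈ e.domain, e.integrand v = 1 := by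
  intro β hβ
  obtain ⟨e, hed, hei⟩ := KZ.exists_oneRep (isSemialgebraic_openDisc hβ) (volume_openDisc_ne_top β)
  exact ⟨e, hed, fun v _ => by rw [hei]⟩

end Summit.KontsevichZagierPeriods.ComplexOrientations.TypeOneIdentities

end
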